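import Literature.AnabelianGeometry.EtaleTheta.KummerMapFunctoriality

/-!
# `G`-equivariance of the Kummer map (LANA §6.1, p.31)

Source: LANA Project interim report [LANA2026Report], §6.1, p. 31: "`κ : M → lim_{→ H} H¹(H, Λ(M))`.
This map is `G`-equivariant with respect to the natural action of `G` on `H¹`."

For a NORMAL subgroup `H ⊴ G` the natural action of `g ∈ G` on `H¹(H, Λ(A))` is the map induced by the
pair (conjugation `γ ↦ g⁻¹ γ g : H → H`, `ζ ↦ g • ζ : Λ(A) → Λ(A)`); this pair is an equivariant
co-morphism `(G, A) → (G, A)` in the sense of `KummerFunctoriality.lean` (`conjCoMorphism g`), so the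
action is an instance of `CoMorphism.H1Map` and the equivariance `g ⋆ κ_H(a) = κ_H(g • a)` is an
instance of the functoriality square (`CoMorphism.map_kummerClass`). PROVED here: the action at level
`H` (`conjAct`), that it sends `κ_H(a)` to `κ_H(g • a)` (`conjAct_kummerClass`), and — for a system of
normal subgroups — its compatibility with the structure maps of the colimit, whence the equivariance of
`κ : A → lim_{→} H¹` in the form `colimMap (conj g) (κ a) = κ (g • a)` (`conjColimMap_kummerMap`).
-/

namespace Literature.AnabelianGeometry.EtaleTheta

open groupCohomology CategoryTheory

namespace CoMorphism

section Conj

variable (G A : Type*) [Group G] [CommGroup A] [MulDistribMulAction G A]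

/-- The co-morphism `(γ ↦ g⁻¹ γ g, m ↦ g • m) : (G, A) → (G, A)` attached to `g ∈ G` (the "natural
action of `G` on `H¹`", [cite: LANA2026Report, §6.1 p.31]): indeed
`g • ((g⁻¹ γ g) • m) = γ • (g • m)`. -/
def conj (g : G) : CoMorphism G A G A where
  groupHom := (MulAut.conj g⁻¹).toMonoidHom
  map := MulDistribMulAction.toMonoidHom A g
  map_smul γ m := by
    change g • ((g⁻¹ * γ * g⁻¹⁻¹) • m) = γ • g • m
    rw [inv_inv, smul_smul, smul_smul, ← mul_assoc, ← mul_assoc, mul_inv_cancel, one_mul]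

variable {G A}

/-- For a normal subgroup `H`, conjugation by `g⁻¹` maps `H` into `H`, so `conj g` relates level `H` to
level `H`. [cite: LANA2026Report, §6.1 p.31] -/
theorem conj_cond (g : G) (H : Subgroup G) [H.Normal] : H.map (conj G A g).groupHom ≤ H := by
  rintro _ ⟨γ, hγ, rfl⟩
  change g⁻¹ * γ * g⁻¹⁻¹ ∈ H
  exact Subgroup.Normal.conj_mem inferInstance γ hγ g⁻¹

/-- `(conj g).map a = g • a`. [cite: LANA2026Report, §6.1 p.31] -/
@[simp] theorem conj_map_apply (g : G) (a : A) : (conj G A g).map a = g • a := rfl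

end Conj

section Level

variable {G : Type} [Group G] {A : Type} [CommGroup A] [MulDistribMulAction G A]
  (H : Subgroup G) [H.Normal]

/-- The natural action of `g ∈ G` on `H¹(H, Λ(A))` for a normal subgroup `H`
[cite: LANA2026Report, §6.1 p.31]: the `H¹`-map of `conj g`. -/
noncomputable def conjAct (g : G) : H1 (cyclotomeRep (A := A) H) ⟶ H1 (cyclotomeRep (A := A) H) :=
  (conj G A g).H1Map (conj_cond g H)

/-- For `a ∈ A^H` and `H` normal, `g • a ∈ A^H`. [cite: LANA2026Report, §6.1 p.31] -/
theorem smul_mem_invariants (g : G) (a : invariants (A := A) H) : g • (a : A) ∈ invariants (A := A) H :=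
  ((conj G A g).mapInvariants (conj_cond g H) a).2

variable [RootableBy A ℕ]

/-- **`G`-equivariance of the Kummer map at level `H`** [cite: LANA2026Report, §6.1 p.31]:
`g ⋆ κ_H(a) = κ_H(g • a)` for `a ∈ A^H`, `H ⊴ G`. -/
theorem conjAct_kummerClass (g : G) (a : invariants (A := A) H) :
    conjAct H g (kummerClass H a) = kummerClass H ⟨g • (a : A), smul_mem_invariants H g a⟩ :=
  (conj G A g).map_kummerClass (conj_cond g H) a

end Level

section Colim

variable {G : Type} [Group G] {A : Type} [CommGroup A] [MulDistribMulAction G A]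
  {ι : Type} [Preorder ι] [DecidableEq ι] [IsDirectedOrder ι] (S : ι → Subgroup G)
  (hS : ∀ ⦃i j : ι⦄, i ≤ j → S j ≤ S i) [hN : ∀ i, (S i).Normal]

omit [Preorder ι] [DecidableEq ι] [IsDirectedOrder ι] in
/-- For a system of NORMAL subgroups, `conj g` relates every level to itself, so the choice `k = id`
witnesses the system condition of `colimMap`. [cite: LANA2026Report, §6.1 p.31] -/
theorem conj_cond_system (g : G) (i : ι) : (S i).map (conj G A g).groupHom ≤ S i := conj_cond g (S i)

/-- The natural action of `g ∈ G` on `lim_{→ i} H¹(S i, Λ(A))` (system of normal subgroups): the map of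
colimits induced by `conj g`. [cite: LANA2026Report, §6.1 p.31] -/
noncomputable def conjColimMap (g : G) : H1Colimit A S hS →+ H1Colimit A S hS :=
  (conj G A g).colimMap S hS S hS id (conj_cond_system S g)

variable [RootableBy A ℕ]

/-- **`G`-equivariance of the Kummer map `κ : A → lim_{→ H} H¹(H, Λ(A))`**
[cite: LANA2026Report, §6.1 p.31] ("This map is `G`-equivariant with respect to the natural action of
`G` on `H¹`"), for a directed system of normal subgroups: `g ⋆ κ(a) = κ(g • a)`. -/
theorem conjColimMap_kummerMap (hc : IsExhausted A S) (g : G) (a : A) :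
    conjColimMap S hS g (kummerMap hS hc a) = kummerMap hS hc (g • a) :=
  (conj G A g).colimMap_kummerMap S hS S hS id (conj_cond_system S g) hc hc a

end Colim

end CoMorphism

end Literature.AnabelianGeometry.EtaleTheta
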